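import Literature.Topology.FourManifolds.WeaklyReducibleTrisections
import HarnessLib

/-!
# A mutually non-separating weak-reducing pair on a genus-three Heegaard surface of `S³` or `S¹ × S²`: one curve is primitive on the other side or one is reducing (Aranda–Zupan 2025, Lemma 3.7)

Topic `Literature/Topology/FourManifolds`, after `WeaklyReducibleTrisections.lean` (curves,
compressing discs and spine handlebodies of a Gay–Kirby trisection) and next to
`GenusThreeSeparatingPairReducing.lean` (the companion Lemma 3.8).  One small DEFINITION and ONE
NAMED FACT; nothing is proved:

* `Literature.Topology.FourManifolds.Trisection.MeetsOnceTransv c c'` — two subsets `c`, `c'` of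
  a smooth `4`-manifold MEET ONCE, TRANSVERSALLY: `c ∩ c' = {x}` is one point, and `c`, `c'` are
  the images of smooth embeddings of the circle whose tangent lines at `x` are distinct.  This
  is the tree's rendering of the geometric-intersection-number-one condition "`|c ∩ c'| = 1`"
  between curves of the central surface that Aranda–Zupan use to define *primitive* curves
  (§2, p. 3: "A curve `c′` in `Σ` is called primitive in `H` if there exists a compressing curve
  `c` for `H` such that `|c ∩ c′| = 1`"), *stabilized* splittings and trisections (§2, pp. 4, 6)
  and five-chains (§5, p. 18).  In print a curve is an isotopy class and `|c ∩ c′|` the geometric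
  intersection number; for CONCRETE curves (the tree's `Trisection.IsCurve`: embedded circles) a
  single transverse intersection point realises intersection number one (one transverse point has
  algebraic intersection `±1`, so no isotopy removes it), and conversely intersection number one
  is realised by transverse representatives meeting once — so statements quantifying
  existentially over concrete curves, as below, say exactly what print says.  Transversality is
  part of the definition on purpose: a bare `c ∩ c' = {x}` also admits a tangential touching,
  which a small isotopy destroys, and would make "primitive" nearly vacuous.
* `Literature.Topology.FourManifolds.arandaZupan_nonSeparatingPair_primitiveOrReducing_gk` —
  Aranda–Zupan, arXiv:2503.04607 (2025), **Lemma 3.7** (p. 9), verbatim: "Suppose `H₁ ∪_Σ H₂`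
  is a genus-three Heegaard splitting of `Y = S³` or `S¹ × S²`, and let `c₁` and `c₂` be a
  weak-reducing pair of mutually non-separating curves.  Then one of the following holds:
  (1) There exists a compressing curve `c′₂` for `H₂` such that `|c′₂ ∩ c₁| = 1` and
  `c′₂ ∩ c₂ = ∅`, (2) There exists a compressing curve `c′₁` for `H₁` such that `|c′₁ ∩ c₂| = 1`
  and `c′₁ ∩ c₁ = ∅`, (3) `c₁` is a reducing curve, or (4) `c₂` is a reducing curve."
  Glossary (loc. cit.): weak-reducing pair = disjoint curves bounding compressing disks in `H₁`,
  `H₂` respectively (§2, p. 5); mutually non-separating = `Σ ∖ (c₁ ∪ c₂)` connected (Remark 2.3,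
  p. 5: "If `c₁` and `c₂` are mutually non-separating, the induced thin surface `Σ_{c₁,c₂}` is a
  torus"); reducing curve = compressing on both sides (§2, p. 4).

## How the fact is rendered (relative to the tree's notions, D-0014)

Exactly as the companion Lemma 3.8 (`GenusThreeSeparatingPairReducing.lean`): for the Heegaard
splittings the tree has language for, the SPINES of Gay–Kirby trisections.  For an orientable
smooth `4`-manifold `M` with a `(3; k₀, k₁, k₂)`-trisection `T` and distinct labels `i, j, l` with
`k l ≤ 1`, the spine handlebodies `H_i`, `H_j` (`Trisection.spineHandlebody`) form the genus-three
Heegaard splitting `H_i ∪_F H_j = ∂X_l ≅ #^{k_l}(S¹ × S²) ∈ {S³, S¹ × S²}`; `x ⊂ H_i`-compressing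
and `y ⊂ H_j`-compressing disjoint non-separating curves of the central surface `F` with
`F ∖ (x ∪ y)` connected; conclusion: the four printed alternatives, (1)/(2) with the dual curve a
concrete compressing curve of the other handlebody meeting the given curve once transversally
(`MeetsOnceTransv`) and disjoint from the other member of the pair, (3)/(4) as "compresses on the
other side as well".  This is the `3`-dimensional input of the pants case of Aranda–Zupan's
Thm. 1.4 (§7, p. 25: "Applying Lemma 3.7 to the Heegaard splitting `H_α ∪ H_β` …  Next, we apply
Lemma 3.7 to the Heegaard splitting `H_α ∪ H_γ`") and of Prop. 3.9 (p. 11).  Orientability of `M`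
is a standing convention of the source (§2, p. 3).

Printed proof (p. 9): untelescope along the pair; the thin surface is a torus, compressible in
`Y` ("neither `S³` nor `S¹ × S²` contains an incompressible torus"); Prop. 2.4 [CG87, ST94] and
Lemma 3.4 make a thick genus-two surface reducible; uniqueness of the non-separating compressing
disc of the small compression body (Lemma 3.5), handle slides over scars (Remark 2.1) and a
genus-one summand `Y* ∈ {S³, S¹ × S²}` give the four cases.  None of this is in the tree; users
take `(h : arandaZupan_nonSeparatingPair_primitiveOrReducing_gk)`.

## References

* R. Aranda, A. Zupan, *Manifolds with weakly reducible genus-three trisections are standard*,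
  arXiv:2503.04607 (2025): Lemma 3.7 (p. 9); §2 (pp. 3–6), Remark 2.3; Prop. 3.9 (pp. 10–11);
  §5 (p. 18); §7 (p. 25).  Held: `paper:arxiv-2503.04607`. [ArandaZupan2025]
* A. Casson, C. Gordon, *Reducing Heegaard splittings*, Topology Appl. 27 (1987). [CG87]
* M. Scharlemann, A. Thompson, *Thin position for 3-manifolds*, Contemp. Math. 164 (1994). [ST94]
* B. Farb, D. Margalit, *A primer on mapping class groups*, PUP (2012), §1.2.3 (geometric
  intersection number, bigon criterion).
-/

noncomputable section

open scoped Manifold ContDiff Topology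
open Set

namespace Literature.Topology.FourManifolds

universe u

namespace Trisection

variable {X : Type u} [TopologicalSpace X] [ChartedSpace (EuclideanSpace ℝ (Fin 4)) X]

/-- **Two curves meet once, transversally** (`|c ∩ c′| = 1` for concrete curves): `c ∩ c'` is a
single point `x`, and `c`, `c'` are the images of smooth embeddings `γ`, `γ'` of the circle
whose tangent lines at `x` meet only in `0` (for curves on the central surface of a trisection:
they cross transversally inside that surface).  The tree's rendering of the intersection-number-one
condition in Aranda–Zupan's "primitive" (§2, p. 3), "stabilized" (pp. 4, 6) and "five-chain"
(p. 18); see the module docstring for why transversality is built in.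
[cite: ArandaZupan2025, §2 (p. 3, primitive curves; pp. 4, 6, stabilized)] -/
def MeetsOnceTransv (c c' : Set X) : Prop :=
  ∃ x : X, c ∩ c' = {x} ∧
    ∃ (γ γ' : (Metric.sphere (0 : EuclideanSpace ℝ (Fin 2)) 1) → X)
      (s s' : Metric.sphere (0 : EuclideanSpace ℝ (Fin 2)) 1),
      Manifold.IsSmoothEmbedding (𝓡 1) (𝓡 4) ∞ γ ∧ range γ = c ∧
      Manifold.IsSmoothEmbedding (𝓡 1) (𝓡 4) ∞ γ' ∧ range γ' = c' ∧ γ s = x ∧ γ' s' = x ∧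
      ∀ (v : TangentSpace (𝓡 1) s) (w : TangentSpace (𝓡 1) s'),
        (mfderiv (𝓡 1) (𝓡 4) γ s v : EuclideanSpace ℝ (Fin 4)) =
          (mfderiv (𝓡 1) (𝓡 4) γ' s' w : EuclideanSpace ℝ (Fin 4)) →
        (mfderiv (𝓡 1) (𝓡 4) γ s v : EuclideanSpace ℝ (Fin 4)) = 0

end Trisection

/-- **Aranda–Zupan 2025, Lemma 3.7 (named fact, on the spine of a genus-three Gay–Kirby
trisection): a mutually non-separating weak-reducing pair — one curve is primitive on the other
side by a dual disjoint from the other curve, or one curve is reducing.**  Printed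
(arXiv:2503.04607, p. 9): "Suppose `H₁ ∪_Σ H₂` is a genus-three Heegaard splitting of `Y = S³`
or `S¹ × S²`, and let `c₁` and `c₂` be a weak-reducing pair of mutually non-separating curves.
Then one of the following holds: (1) There exists a compressing curve `c′₂` for `H₂` such that
`|c′₂ ∩ c₁| = 1` and `c′₂ ∩ c₂ = ∅`, (2) There exists a compressing curve `c′₁` for `H₁` such that
`|c′₁ ∩ c₂| = 1` and `c′₁ ∩ c₁ = ∅`, (3) `c₁` is a reducing curve, or (4) `c₂` is a reducing
curve."  Here: `M` an orientable smooth `4`-manifold with a `(3; k₀,k₁,k₂)`-trisection `T`;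
`i, j, l` the three labels with `k l ≤ 1`, so that `H_i ∪_F H_j = ∂X_l ≅ #^{k_l}(S¹ × S²)` is a
genus-three Heegaard splitting of `S³` or `S¹ × S²` (`H₁ = H_i`, `H₂ = H_j`,
`H_p = Trisection.spineHandlebody T p`, `F` the central surface); `c₁ = x`, `c₂ = y` disjoint
curves on `F`, each non-separating, `F ∖ (x ∪ y)` connected, `x` compressing in `H_i`, `y` in
`H_j`; conclusion: (1) a compressing curve `y'` of `H_j` meeting `x` once transversally
(`Trisection.MeetsOnceTransv`) and disjoint from `y`, or (2) a compressing curve `x'` of `H_i`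
meeting `y` once transversally and disjoint from `x`, or (3) `x` compresses in `H_j` as well, or
(4) `y` compresses in `H_i` as well.  Users take
`(h : arandaZupan_nonSeparatingPair_primitiveOrReducing_gk)`.
-- TODO(general form): every genus-three Heegaard splitting `H₁ ∪_Σ H₂` of `S³` or `S¹ × S²`
-- (`IsHeegaardSplitting` of `LickorishWallace.lean`), not only the spines of trisections.
[cite: ArandaZupan2025, Lemma 3.7 (p. 9); §2 (pp. 3–5) and Remark 2.3; §7 (p. 25)] -/
def arandaZupan_nonSeparatingPair_primitiveOrReducing_gk : Prop :=
  ∀ (M : Type u) [TopologicalSpace M] [T2Space M] [SecondCountableTopology M]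
    [ChartedSpace (EuclideanSpace ℝ (Fin 4)) M] [IsManifold (𝓡 4) ∞ M],
    IsOrientable (𝓡 4) M → ∀ (k : Fin 3 → ℕ) (T : Fin 3 → Set M), IsGKTrisection M 3 k T →
    ∀ i j l : Fin 3, i ≠ j → l ≠ i → l ≠ j → k l ≤ 1 →
    ∀ x y : Set M, Trisection.IsCurve T x → Trisection.IsCurve T y → Disjoint x y →
      Trisection.IsNonSeparating T x → Trisection.IsNonSeparating T y →
      IsConnected (Trisection.centralSurfaceSet T \ (x ∪ y)) →
      Trisection.BoundsDisc T (Trisection.spineHandlebody T i) x →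
      Trisection.BoundsDisc T (Trisection.spineHandlebody T j) y →
      (∃ y' : Set M, Trisection.IsCurve T y' ∧
          Trisection.BoundsDisc T (Trisection.spineHandlebody T j) y' ∧
          Trisection.MeetsOnceTransv y' x ∧ Disjoint y' y) ∨
      (∃ x' : Set M, Trisection.IsCurve T x' ∧
          Trisection.BoundsDisc T (Trisection.spineHandlebody T i) x' ∧
          Trisection.MeetsOnceTransv x' y ∧ Disjoint x' x) ∨
      Trisection.BoundsDisc T (Trisection.spineHandlebody T j) x ∨
      Trisection.BoundsDisc T (Trisection.spineHandlebody T i) y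

end Literature.Topology.FourManifolds

end
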